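import Summits.QuantumFields.YangMills.Theorems.FluctuationComparisonRegPrIntLS2BetaAveragedBondStraightWord
import Summits.QuantumFields.YangMills.Theorems.FluctuationComparisonRegPrIntLS2BetaAveragedBondWord
import HarnessLib

/-!
# S2β · c₁ column — «THE LINE RECURSION `ε` DISCHARGED BY ITS LEAST SOLUTION»: the displayed letters `(hε0 : ε 0 = 0) (hεnn : 0 ≤ ε i) (hε : L·ε i + 2·α i ≤ ε (i+1))
# (hεp : ε i ≤ Cε·L^{2i}·q)` of ✓p840777 ∕ ✓p840940 ∕ w4 g29's (g2) `c1Budget_physical` are ALL met by the explicit choice `ε k := Σ_{i<k} L^{k−1−i}·(2·α i)` with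
# `Cε := 2·Cα∕(L²−L)` under the one-power profile `α i ≤ Cα·L^{2i}·q` — pure real arithmetic (✓p840574 `geomSeq_of_theta`, px20 g25 ✓`geom_mixed_sum`)

Cell `ym3-torus` (YM ladder rung R3 = continuum `SU(2)` Yang–Mills on the three-torus at fixed lattice data — a RUNG: NOT d = 4, NOT infinite volume, NOT a mass gap,
NOT Clay).  Width seat «width 12» `ym3-torus-px12` (gen 27); crux `stmt-QuantumFields-20520`, LINE g18-1 S2β, c₁ column.  `--kind proof --supports stmt-QuantumFields-20520 --as helper`,
count-neutral, DEFINITION-FREE (0 `def`, 0 `instance`, 0 `notation`, 0 `sorry`, default heartbeats).  No lattice object.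

WHAT IS PROVED (sorry-free), for `εL L α k := Σ_{i<k} L^{k−1−i}·(2·α i)` written out: `epsLeast_zero` (`= 0` at `k = 0`), `epsLeast_succ` (`L·εL k + 2·α k = εL (k+1)` — ✓`geomSeq_of_theta`),
`epsLeast_nonneg` (`0 ≤ α` ⇒ `0 ≤ εL k`), ★★`epsLeast_le_profile` (`1 < L`, `0 ≤ q`, `0 ≤ Cα`, `α i ≤ Cα·L^{2i}·q` for `i < k` ⇒ `εL k ≤ (2·Cα∕(L²−L))·(L^{2k}·q)`),
★★★**`epsLetters_of_profile`** — the four letters at once for the consumer's `∀ i < n` ranges.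

HONEST SCOPE.  Arithmetic; nothing of Bałaban's renormalisation-group analysis proved; the `α`-profile (BKG class) is a HYPOTHESIS; GAP♯∘ (`stub_uniformFibreGapOrbit`, registry 3732b7df UNTOUCHED, 0∕5),
the five registered stubs, S2β, crux 20520, 19936, 19200, `YM3TorusSU2` — NOT proved; rung R3 — NOT d = 4, NOT infinite volume, NOT a mass gap, NOT Clay; the Yang–Mills mass gap is NOT proved.
-/

set_option autoImplicit false

namespace Summit.QuantumFields.YangMills.Theorems.FluctuationComparisonRegPrIntLS2BetaCurvatureRecursionLeast

open Summit.QuantumFields.YangMills.Theorems.FluctuationComparisonRegPrIntLS2BetaAveragedBondStraightWord (geomSeq_of_theta)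
open Summit.QuantumFields.YangMills.Theorems.FluctuationComparisonRegPrIntLS2BetaAveragedBondWord (geom_mixed_sum)

/-- `εL 0 = 0`. [folklore] -/
theorem epsLeast_zero (L : ℝ) (α : ℕ → ℝ) : ∑ i ∈ Finset.range 0, L ^ (0 - 1 - i) * (2 * α i) = 0 := by
  rw [Finset.range_zero, Finset.sum_empty]

/-- `L·εL k + 2·α k = εL (k+1)` (✓p840574 `geomSeq_of_theta`). [folklore] -/
theorem epsLeast_succ (L : ℝ) (α : ℕ → ℝ) (k : ℕ) :
    L * (∑ i ∈ Finset.range k, L ^ (k - 1 - i) * (2 * α i)) + 2 * α k = ∑ i ∈ Finset.range (k + 1), L ^ (k + 1 - 1 - i) * (2 * α i) :=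
  geomSeq_of_theta L α k

/-- `0 ≤ εL k` for `0 ≤ L`, `0 ≤ α`. [folklore] -/
theorem epsLeast_nonneg {L : ℝ} (hL : 0 ≤ L) {α : ℕ → ℝ} (hα : ∀ i, 0 ≤ α i) (k : ℕ) :
    0 ≤ ∑ i ∈ Finset.range k, L ^ (k - 1 - i) * (2 * α i) :=
  Finset.sum_nonneg fun i _ => mul_nonneg (pow_nonneg hL _) (by linarith [hα i])

/-- ★★ `εL k ≤ (2·Cα∕(L²−L))·(L^{2k}·q)` under `α i ≤ Cα·L^{2i}·q` (`i < k`), `1 < L`, `0 ≤ q`, `0 ≤ Cα` (px20 g25 ✓`geom_mixed_sum`). [folklore] -/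
theorem epsLeast_le_profile {L q Cα : ℝ} (hL : 1 < L) (hq : 0 ≤ q) (hCα : 0 ≤ Cα) {α : ℕ → ℝ} (k : ℕ)
    (hαp : ∀ i, i < k → α i ≤ Cα * L ^ (2 * i) * q) :
    ∑ i ∈ Finset.range k, L ^ (k - 1 - i) * (2 * α i) ≤ (2 * Cα / (L ^ 2 - L)) * (L ^ (2 * k) * q) := by
  have hL0 : 0 ≤ L := by linarith
  have h1 : ∑ i ∈ Finset.range k, L ^ (k - 1 - i) * (2 * α i) ≤ ∑ i ∈ Finset.range k, (2 * Cα * q) * (L ^ (k - 1 - i) * L ^ (2 * i)) := by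
    refine Finset.sum_le_sum fun i hi => ?_
    rw [Finset.mem_range] at hi
    have hp : 0 ≤ L ^ (k - 1 - i) := pow_nonneg hL0 _
    calc L ^ (k - 1 - i) * (2 * α i) ≤ L ^ (k - 1 - i) * (2 * (Cα * L ^ (2 * i) * q)) :=
          mul_le_mul_of_nonneg_left (by linarith [hαp i hi]) hp
      _ = (2 * Cα * q) * (L ^ (k - 1 - i) * L ^ (2 * i)) := by ring
  refine h1.trans ?_
  rw [← Finset.mul_sum, geom_mixed_sum L hL k]
  have hLL : 0 < L ^ 2 - L := by nlinarith
  have hLk : 0 ≤ L ^ k := pow_nonneg hL0 k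
  rw [show (2 * Cα / (L ^ 2 - L)) * (L ^ (2 * k) * q) = (2 * Cα * q) * (L ^ (2 * k) / (L ^ 2 - L)) by ring]
  refine mul_le_mul_of_nonneg_left ?_ (by positivity)
  rw [div_le_div_iff_of_pos_right hLL]
  linarith

/-- ★★★ **THE FOUR `ε`-LETTERS OF THE c₁ COLUMN AT ONCE** for `ε k := Σ_{i<k} L^{k−1−i}·(2·α i)`: `ε 0 = 0`, `0 ≤ ε k`, `L·ε i + 2·α i ≤ ε (i+1)` (with equality), and the profile
`ε i ≤ (2·Cα∕(L²−L))·(L^{2i}·q)` for every `i ≤ n` under `α j ≤ Cα·L^{2j}·q` (`j < n`). [folklore] -/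
theorem epsLetters_of_profile {L q Cα : ℝ} (hL : 1 < L) (hq : 0 ≤ q) (hCα : 0 ≤ Cα) {α : ℕ → ℝ} (hα0 : ∀ i, 0 ≤ α i) (n : ℕ)
    (hαp : ∀ j, j < n → α j ≤ Cα * L ^ (2 * j) * q) :
    (∑ i ∈ Finset.range 0, L ^ (0 - 1 - i) * (2 * α i) = 0) ∧
    (∀ k, 0 ≤ ∑ i ∈ Finset.range k, L ^ (k - 1 - i) * (2 * α i)) ∧
    (∀ k, L * (∑ i ∈ Finset.range k, L ^ (k - 1 - i) * (2 * α i)) + 2 * α k ≤ ∑ i ∈ Finset.range (k + 1), L ^ (k + 1 - 1 - i) * (2 * α i)) ∧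
    (∀ k, k ≤ n → ∑ i ∈ Finset.range k, L ^ (k - 1 - i) * (2 * α i) ≤ (2 * Cα / (L ^ 2 - L)) * (L ^ (2 * k) * q)) :=
  ⟨epsLeast_zero L α, epsLeast_nonneg (by linarith) hα0, fun k => (epsLeast_succ L α k).le,
    fun k hk => epsLeast_le_profile hL hq hCα k fun i hi => hαp i (by omega)⟩

end Summit.QuantumFields.YangMills.Theorems.FluctuationComparisonRegPrIntLS2BetaCurvatureRecursionLeast
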